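import Literature.Computability.Complexity.Williams2014Transfer
import Literature.Computability.Complexity.CircuitSizeProofs
import HarnessLib

/-!
# Murray–Williams 2018: the Easy Witness Lemma for low nondeterministic time (Lemma 4.1), as a
# named fact, and unary languages

Second layer of the decomposition of
`Literature.Computability.Complexity.MurrayWilliams2018_NQP_not_subset_ACC0 : ¬ (NQP ⊆ ACC0)`
(`CircuitLowerBounds.lean`, `MurrayWilliams2018.lean`, `MurrayWilliams2018NQP.lean`): the named
fact `MurrayWilliams2018_thm_1_2_acc` (Murray–Williams 2018, Thm. 1.2 for the slices of `ACC⁰`)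
is proved in the source (§5, pp. 13–16) from

* the **Easy Witness Lemma for low nondeterministic time** (Lemma 4.1, the paper's main new
  result; Lemmas 1.2/1.3 are its cases `s(n) = nᵏ`, `s(n) = 2^{logᵏ n}`), vendored here as
  `MurrayWilliams2018_lemma_4_1` over the tree's verifier data `NVerifier`
  (`Williams2014Transfer.lean`) and the notion `HasWitnessCircuits` below;
* the **nondeterministic time hierarchy theorem**, quoted on p. 14 with a unary hard language
  ("Take `L ∈ NTIME[t(n)] − NTIME[t(n)^{1−ε/2}]` such that `L ⊆ {1ⁿ | n ≥ 0}` [SFM78, Žák83]";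
  Seiferas–Fischer–Meyer 1978, Thm. 5; Žák 1983, §1.2 and Thm. 2.2: for a running time `t` one
  language `L ⊆ 1*` lies in `NTIME(t) ∖ ⋃{NTIME(t') | t'(n+1) = o(t(n))}`). The tree PROVES the
  hierarchy theorem with a binary hard language (`Diag.ntime_hierarchy_holds`, `DiagMachine.lean`:
  time-constructible `f`, `g` with `f(n+1) = o(g(n))` give `NTIME g ⊄ NTIME f`; the chain words
  `H 0 1ʲ` of its diagonalizer are in the manner of Žák's two-letter variant, Remark 2.4), and the
  assembly of Thm. 1.2 in `MurrayWilliams2018Hierarchy.lean` runs §5 on that language —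
  legitimately: no step of the simulation `N` of §5 reads the letters of its input, and the
  source's own Remark 1 runs the argument on a non-unary `L`. Žák's one-letter form (a second
  diagonalizer, over unary inputs, recovering the simulated machine from the input LENGTH by
  his "unpadding" process) is therefore NOT vendored as a named fact (D-0026: it had become an
  unproved fact without a live consumer); only the notion of a unary language (`IsUnaryLanguage`,
  used to state the source's form of the simulation hypothesis) is kept here;
* the PCP of Ben-Sasson–Viola 2014 with projection queries, `EVAL-GATE ∈ P` and the circuit `D`
  (not vendored here: PCP verifiers producing oracle circuits have no tree notion yet).

Lemma 4.1 rests in turn on Thm. 3.1 (the "almost" almost-everywhere circuit lower bound for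
`MA` with advice, via Santhanam's checkable `PSPACE`-complete language, Thm. 2.2, and the
diagonal language of Thm. 2.3) and on Umans' pseudorandom generator (Thm. 2.1); these need
Merlin–Arthur time classes with advice and generators fooling `SIZE`, and are left to the files
that attack the lemma.

## The notion of witness circuits

Murray–Williams, §2: an algorithm `V(x, y)` is a verifier for `L ∈ NTIME[t(n)]` if it runs in
time `O(t)` and `x ∈ L ⟺ ∃ y` of length `O(t(n))` with `V(x, y)` accepting; "`V` has witness
circuits of size `w(n)` if for all strings `x`, if `x ∈ L(V)` then there is a `yₓ` … such that
`V(x, yₓ)` accepts and `yₓ` has circuit complexity at most `w(n)`", the circuit complexity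
`CC(y)` of a string being that of the function with truth table `y 1 0⋯0` on the least number of
variables; "`L` has witness circuits of size `w(n)` if every verifier for `L` has witnesses of
size `w(n)`". Over the tree: verifiers are the data `NVerifier t L` of `L ∈ NTIME t`
(`mem_NTIME_iff_nonempty_nVerifier`), and — as in `HasUniversalWitnessCircuits` of
`Williams2014Transfer.lean` — a witness `y` is *encoded* by a `B₂`-circuit `W` when `y` is a
prefix of the truth table of `W` (`MetaComplexity.truthTable`, least significant bit first).
`CC(y) ≤ w` in the printed sense gives such a `W` with at most `w` gates (the circuit for
`y 1 0⋯0`, inputs relabelled to the tree's enumeration; `B₂` contains every fan-in-two basis),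
so the encoded form is implied by the printed one. We ask it for all SUFFICIENTLY LONG `x ∈ L`
(`HasWitnessCircuits`: `∃ n₀, ∀ x ∈ L, n₀ ≤ |x| → …`): the printed "for all strings `x`" cannot be
meant literally (for `|x| = 0` the bound `w(0)` may be `0`), all estimates of the printed proof are
asymptotic, and the applications (§5) use the witnesses on the infinitely many lengths of a hard
unary language; the eventual form is the weaker statement.

Addendum. (1) `MurrayWilliams2018_lemma_4_1` renders the hypothesis `NTIME[O(tᵉ)] ⊂ SIZE[s]`
with the tree's all-lengths class `SIZE s` (`CircuitClasses.lean`), the literal reading; that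
class is EMPTY whenever `s 0 = 0` (a circuit on no inputs has a gate) and misses every language
with a hard slice at some small length, so for such `s` the implication holds vacuously. The
printed proof uses the assumed circuits only at the large lengths `nᵢ`, `s₂(nᵢ)` of its bad
inputs (p. 12: the simulation `N` "has circuits of size `s((2d + 2)n)`"), i.e. it establishes the
lemma under the almost-everywhere hypothesis `∀ L ∈ NTIME (t · ^ e), ∀ᶠ n, L.circuitSize n ≤ s n`
— the reading of `SIZE` that `EasyWitness.lean` adopts for IKW. This form is recorded as
`MurrayWilliams2018_lemma_4_1_ae` (with the printed hypothesis "increasing `t`", see the review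
section below; the literal form, a theorem of the tree as it stands —
`MurrayWilliams2018_lemma_4_1_holds`, `MurrayWilliams2018EasyWitnessProofs.lean`, vacuously —
keeps its wider quantification over all time-constructible `t`, so the almost-everywhere form no
longer specialises to it by instantiation and the former bridge `…_ae.lemma_4_1` is withdrawn).
(2) The diagonal language of
Thm. 2.3 (Thm. 2.8 of the SICOMP version: for space-constructible `s(n) < 2ⁿ/(2n)` a language
`L_diag ∈ SPACE[s(n)²]` without `s(n)`-size circuits for all but finitely many `n`; "folklore",
by exhaustive search in space `O(s(n)²)`) is NOT vendored as a named fact: its only use in the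
paper is inside the proof of Thm. 3.1, and its `SPACE[s(n)²]` half asks for a space-bounded search
machine over the tree's `SpaceMachine` (`Space.lean`) that does not exist yet, so it stays part of
the proof obligation of `MurrayWilliams2018_lemma_4_1_ae`, with Thm. 3.1 and Thm. 2.1 (D-0026).

## Review of the decomposition child `MurrayWilliams2018_lemma_4_1_ae` (D-0026, 2026-08-15)

`MurrayWilliams2018_lemma_4_1_ae` was minted while decomposing
`MurrayWilliams2018_NQP_not_subset_ACC0` and its prove-seat triaged it XL. Verdict of the
bad-split review (source re-read: ECCC TR17-188, pp. 12–14 = STOC text pp. 13–14): KEPT as a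
named fact and RESTATED; not provable inline now.

1. *Faithfulness — restated.* The printed lemma quantifies over "increasing time-constructible
   `s(n)`, `s₂(n) := s(e·n)ᵉ`, and `t(n)`", and the proof USES that `t` is non-decreasing: its
   last display bounds the running time of the simulation `N` on inputs of length `s′₂(nᵢ)` by
   "`O(s₂(s₂(s₂(nᵢ)))² + t(nᵢ)^{a+g} + t(nᵢ)ᵍ · s₂(s₂(s₂(nᵢ)))²) ≤ O(t(nᵢ)^{a+g}) ≤
   O(t(s′₂(nᵢ))^{a+g})`, where in the next-to-last inequality, we have applied constraint (b)"
   (ECCC p. 14) — the last inequality is `t(nᵢ) ≤ t(s′₂(nᵢ))` for `nᵢ ≤ s′₂(nᵢ)`. The tree's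
   `IsTimeConstructible t` (`Classes.lean`) gives `n ≤ t n` and computability, not monotonicity,
   and no other hypothesis bounds `t(nᵢ)` in terms of `t(s′₂(nᵢ))` ((b) is a lower bound only), so
   the statement landed in p24292 (no monotonicity of `t`) was stronger than what the source
   proves. It now carries `Monotone t` — "increasing" in the non-decreasing sense, which is all
   the proof uses (a weaker hypothesis than strict increase would be unwarranted only if the proof
   needed strictness; it does not). The one application in the tree,
   `MurrayWilliams2018_lemma_1_3_of_lemma_4_1_ae` (`MurrayWilliams2018Lemma13.lean`), takes
   `t = smoothQP E`, which is monotone (`smoothQP_mono`); every other user only threads the fact.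
2. *Cut.* The child is Lemma 4.1 itself — the paper's main technical result, a distinct printed
   statement with its own locator, consumed (through Lemma 1.3,
   `MurrayWilliams2018_lemma_1_3_of_lemma_4_1_ae`) by the conditional forms of Thm. 1.2 /
   `NQP ⊄ ACC⁰` — `MurrayWilliams2018_thm_1_2_acc_of_EWL_of_simulation`,
   `…_of_EWL_of_levelSimulation`, `…_of_EWL_of_expSimulation` and their `…_of_lemma_4_1_ae_…`
   corollaries in `MurrayWilliams2018{Hierarchy,LevelSimulation,ExpLevel}.lean` — not a slice of
   the parent's proof and not an orphan, so it is neither merged back nor dropped. It is,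
   however, not M-sized, and no depth-one cut of it into M-sized PUBLISHED results exists in the
   tree's present state (item 3); decompositions do not recurse, so no further named facts are
   minted for it.
3. *Discharge status: XL — a theory, not an inline proof.* The printed proof (§4, one page) is
   an assembly; what it assembles is absent from the tree (`lean search`, 2026-08-15: no
   declaration for any of the following): (i) Thm. 3.1, the "almost" almost-everywhere circuit
   lower bound for Merlin–Arthur time WITH ADVICE (§3), resting on Santhanam's paddable,
   downward-self-reducible, same-length-checkable `PSPACE`-complete language (Thm. 2.2 = [San07]
   over [TV02], i.e. the `IP = PSPACE` protocol turned into a language), on polynomial-time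
   reductions of every `SPACE[s(n)]` language to it at scale `s` (Claim 1), on the diagonal
   language of Thm. 2.3 in `SPACE[s²]` (a space-bounded exhaustive search; un-vendored, p36313)
   and on the bootstrapping Lemma 3.1 — the tree has `MA = MA(2)` (`ArthurMerlinGames.lean`),
   the advice operator `advice` (`EasyWitness.lean`) and `PSPACE`-completeness only as the
   unproved named fact `TQBF_isComplete_PSPACE`
   (`Barriers/QuantumAdvantage/FortnowRogersOracle.lean`), but no Merlin–Arthur TIME classes,
   no checkable complete language, no instance checkers, no
   interactive proof for `PSPACE` (the sumcheck development `Sumcheck*.lean` is the `coNP ⊆ IP`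
   protocol for `UNSAT`); (ii) Thm. 2.1, Umans' generator [Uma03]: seed
   length `g · log |Y|` and running time `poly(|Y|)` at EVERY hardness level `CC(Y) ≥ sᵍ`
   (reconstructive list decoding of Reed–Muller codes); (iii) the simulation `N` with
   `(2d′+1)n` bits of advice folded into the input length and the time-`O(t)`-to-size-`t²`
   circuit conversion (§2). A prove-seat holding this fact should not attempt it inline before
   (i) and (ii) exist; (i) and (ii) are landmark published theorems in their own right (Santhanam
   2007, Thm. 1.3/Lemma 2.x; Trevisan–Vadhan 2002; Umans 2003, Thm. 1) and belong to litbuild /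
   cite seats as top-level facts with their own provenance, not to a split of this lemma.
4. *What the tree's generator line does give (for a planner re-cutting this cone).* The
   Nisan–Wigderson development (`NWGenerator*.lean`, `MetaComplexity/NWPseudorandom.lean`,
   `HardCoreLemma.lean`, `IWAmplification.lean`, `MultilinearExtension.lean`; plan S1–S2 in
   `IKWGenerators.lean`) yields generators with seed length `O(log²|Y| / log m)` against size-`m`
   tests from a table `Y` of hardness `poly(m)`. That suffices for the two printed COROLLARIES
   that the parent actually consumes — Lemma 1.2 (`NP`) and Lemma 1.3 (`NQP`, the hypothesis
   `hEWL` of `MurrayWilliams2018_thm_1_2_acc_of_EWL_of_simulation` and its variants): there the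
   hypothesis covers every
   polynomial (quasi-polynomial) level, so the derandomised simulation may run in any polynomial
   (quasi-polynomial) time and the `2^{seed}` enumeration (`n^{O(1)}`, resp. `2^{polylog n}`) is
   absorbed — but NOT for Lemma 4.1 as printed, whose single exponent `e` (`N ∈ NTIME[tᵉ]` for
   one `e` serving all `s`, `t`, with `t` unbounded in terms of `w = s₂(s₂(s₂(n)))^{2g}`) is
   exactly what requires seed `O(log |Y|)` at all hardness levels. A re-cut at Lemma 1.3 would
   therefore trade ingredient (ii) for the tree's own line; ingredient (i) (at
   `s(n) = 2^{(log n)ᵏ}`) remains the obstacle either way.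

## References

* C. D. Murray, R. R. Williams, *Circuit lower bounds for nondeterministic quasi-polytime: an easy
  witness lemma for NP and NQP*, STOC 2018 (ECCC TR17-188), §2 (witness circuits, circuit
  complexity of strings; Thms. 2.1–2.3), §3 (Thm. 3.1, Lemma 3.1), Lemma 4.1 and its proof
  (ECCC pp. 12–14; the last display, p. 14, uses `t` increasing), §5 (proof of Thm. 1.1, p. 14)
  [MurrayWilliams2018].
* C. Umans, *Pseudo-random generators for all hardnesses*, J. Comput. Syst. Sci. 67 (2003)
  419–440, Thm. 1 (quoted as MW Thm. 2.1).
* R. Santhanam, *Circuit lower bounds for Merlin–Arthur classes*, STOC 2007 / SIAM J. Comput. 39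
  (2009), the `PSPACE`-complete language with an instance checker (quoted as MW Thm. 2.2), after
  L. Trevisan, S. Vadhan, *Pseudorandomness and average-case complexity via uniform reductions*,
  CCC 2002.
* S. Žák, *A Turing machine time hierarchy*, Theoret. Comput. Sci. 26 (1983) 327–333, §1.2 and
  Thm. 2.2, Cor. 2.9 [Zak1983].
* J. I. Seiferas, M. J. Fischer, A. R. Meyer, *Separating nondeterministic time complexity
  classes*, J. ACM 25 (1978) 146–167, Thm. 4 and Thm. 5 [SeiferasFischerMeyer1978].
* R. Williams, *Nonuniform ACC circuit lower bounds*, J. ACM 61 (2014), §5 (witness circuits)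
  [Williams2014].
-/

namespace Literature.Computability.Complexity

open Filter Asymptotics

/-! ### Witness circuits for the tree's verifiers -/

/-- **Witness circuits** (Murray–Williams 2018, §2; Williams 2014, §5), eventual form over the
tree's verifier data: `HasWitnessCircuits t L w` says that for every correct `t`-time verifier
`V` of `L` (`NVerifier t L`) there is a threshold `n₀` such that every `x ∈ L` with `|x| ≥ n₀` has
a witness `y` inside `V`'s length bound, accepted by `V`, which is a prefix of the truth table
(`MetaComplexity.truthTable`) of a `B₂`-circuit with at most `w |x|` gates ("`V` has witness
circuits of size `w(n)`"; "`L` has witness circuits of size `w(n)` if every verifier for `L` has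
witnesses of size `w(n)`"; see the module docstring for the encoding and the threshold).
[cite: MurrayWilliams2018, §2 (Witness Circuits)] -/
def HasWitnessCircuits (t : ℕ → ℕ) (L : Language Bool) (w : ℕ → ℕ) : Prop :=
  ∀ V : NVerifier t L, ∃ n₀ : ℕ, ∀ x ∈ L, n₀ ≤ x.length →
    ∃ (m : ℕ) (W : Circuit (Fin m)) (y : List Bool), W.IsOver B2 ∧ W.size ≤ w x.length ∧
      y.length ≤ V.c * t x.length + V.c ∧ V.rel x y = true ∧
        y <+: MetaComplexity.truthTable W.eval

/-- Witness circuits of size `w` are witness circuits of any eventually larger size `w'`.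
[folklore] -/
theorem HasWitnessCircuits.mono {t : ℕ → ℕ} {L : Language Bool} {w w' : ℕ → ℕ}
    (h : HasWitnessCircuits t L w) (hw : ∀ᶠ n in atTop, w n ≤ w' n) :
    HasWitnessCircuits t L w' := by
  intro V
  obtain ⟨n₀, hn₀⟩ := h V
  obtain ⟨n₁, hn₁⟩ := eventually_atTop.1 hw
  refine ⟨max n₀ n₁, fun x hx hle => ?_⟩
  obtain ⟨m, W, y, hW, hsz, hy, hrel, hpre⟩ := hn₀ x hx ((le_max_left _ _).trans hle)
  exact ⟨m, W, y, hW, hsz.trans (hn₁ _ ((le_max_right _ _).trans hle)), hy, hrel, hpre⟩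

/-- `NTIME t` *has witness circuits of size `w`*: every `L ∈ NTIME t` has
(Murray–Williams 2018, §2: "`NTIME[t(n)]` has witness circuits of size `w(n)` if every
`L ∈ NTIME[t(n)]` has witness circuits of size `w(n)`"). [cite: MurrayWilliams2018, §2 (Witness Circuits)] -/
def NTIMEHasWitnessCircuits (t w : ℕ → ℕ) : Prop :=
  ∀ L ∈ NTIME t, HasWitnessCircuits t L w

/-! ### Lemma 4.1: easy witnesses for low nondeterministic time -/

/-- The stretched size function `s₂(n) := s(e · n)ᵉ` of Murray–Williams 2018, Lemma 4.1.
[cite: MurrayWilliams2018, Lemma 4.1] -/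
def stretch (s : ℕ → ℕ) (e : ℕ) (n : ℕ) : ℕ := s (e * n) ^ e

/-- Unfolding of `stretch` (definitional). [folklore] -/
@[simp] theorem stretch_apply (s : ℕ → ℕ) (e n : ℕ) : stretch s e n = s (e * n) ^ e := rfl

/-- **The Easy Witness Lemma for low nondeterministic time** (Murray–Williams 2018, Lemma 4.1:
"There are `e, g ≥ 1` such that for every increasing time-constructible `s(n)`,
`s₂(n) := s(e·n)ᵉ`, and `t(n)`, if `NTIME[O(t(n)ᵉ)] ⊂ SIZE[s(n)]` then every `L ∈ NTIME[t(n)]`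
has witness circuits of size `s₂(s₂(s₂(n)))^{2g}`, provided that (a) `s(n) < 2^{n/e}/n` and
(b) `t(n) ≥ s₂(s₂(s₂(n)))ᵈ` for a sufficiently large constant `d`." Its cases: Lemma 1.2, `NP ⊂
SIZE[nᵏ] ⟹` witness circuits of size `n^{O(k³)}`; Lemma 1.3, `NQP ⊂ SIZE[2^{logᵏ n}] ⟹` witness
circuits of size `2^{O(log^{k³} n)}`.) Over the tree: `s` strictly increasing and, like `t`,
time constructible in the Sipser form `IsTimeConstructible` (`Classes.lean`) — the printed
"increasing" also qualifies `t` and is used by the proof (see `MurrayWilliams2018_lemma_4_1_ae`,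
which carries it); this literal form omits it, which is immaterial because the literal form is a
theorem of the tree as stated (`MurrayWilliams2018_lemma_4_1_holds`, vacuously); the universal
constants `e, g, d ≥ 1` existential; (a) and (b) for all sufficiently large `n` (the reading of
the printed proof, p. 11: "`s'(n) = s(e·n) < 2^{e·n/e}/(e·n) < 2ⁿ/(2n)` for all sufficiently large
`n`"), with `2^{n/e}` in natural division (a stronger proviso); the hypothesis
`NTIME (t · ^ e) ⊆ SIZE s` with the tree's all-lengths `SIZE` over `B₂` (at least as strong as the
printed inclusion); the conclusion in the encoded, eventual form `HasWitnessCircuits` (module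
docstring). [cite: MurrayWilliams2018, Lemma 4.1] -/
def MurrayWilliams2018_lemma_4_1 : Prop :=
  ∃ e g d : ℕ, 1 ≤ e ∧ 1 ≤ g ∧ 1 ≤ d ∧
    ∀ (s t : ℕ → ℕ), StrictMono s → IsTimeConstructible s → IsTimeConstructible t →
      (∀ᶠ n in atTop, n * s n < 2 ^ (n / e)) →
      (∀ᶠ n in atTop, ((stretch s e)^[3] n) ^ d ≤ t n) →
      NTIME (fun n => t n ^ e) ⊆ SIZE s →
        NTIMEHasWitnessCircuits t (fun n => ((stretch s e)^[3] n) ^ (2 * g))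

/-! ### Unary languages -/

/-- A *unary* (tally) language: every word is a string of `1`s (Seiferas–Fischer–Meyer 1978,
§3: "languages over a one-letter alphabet"; here inside `{0,1}*` as words over `{1}`). [folklore] -/
def IsUnaryLanguage (L : Language Bool) : Prop :=
  ∀ x ∈ L, ∀ b ∈ x, b = true

/-- A unary language contains, in each length, at most the word `1ⁿ`. [folklore] -/
theorem IsUnaryLanguage.eq_replicate {L : Language Bool} (h : IsUnaryLanguage L) {x : List Bool}
    (hx : x ∈ L) : x = List.replicate x.length true :=
  List.eq_replicate_iff.2 ⟨rfl, h x hx⟩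

/-! ### Lemma 4.1 in the almost-everywhere form of `SIZE` -/

/-- **The Easy Witness Lemma for low nondeterministic time, almost-everywhere form of the
hypothesis** (Murray–Williams 2018, Lemma 4.1, as its printed proof establishes it: the assumed
`s(n)`-size circuits for `NTIME[O(tᵉ)]` are used only at the large lengths of the bad inputs,
p. 12). As `MurrayWilliams2018_lemma_4_1` except that (i) "`NTIME[O(t(n)ᵉ)] ⊂ SIZE[s(n)]`" is
rendered `∀ L ∈ NTIME (t · ^ e), ∀ᶠ n, L.circuitSize n ≤ s n` (`Language.circuitSize`, `B₂`
gates; the convention of `EasyWitness.lean` for IKW's `SIZE`) instead of with the all-lengths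
class `SIZE s`, which is empty for `s 0 = 0` (see the module docstring, Addendum), and (ii) `t`
is, as printed ("for every increasing time-constructible `s(n)` … and `t(n)`"), non-decreasing:
`Monotone t` — the proof uses exactly `t(nᵢ) ≤ t(s′₂(nᵢ))`, in the last display of the printed
proof (ECCC TR17-188, p. 14; module docstring, review section, item 1). This is the form to
discharge and to use. [cite: MurrayWilliams2018, Lemma 4.1 (proof)] -/
def MurrayWilliams2018_lemma_4_1_ae : Prop :=
  ∃ e g d : ℕ, 1 ≤ e ∧ 1 ≤ g ∧ 1 ≤ d ∧
    ∀ (s t : ℕ → ℕ), StrictMono s → IsTimeConstructible s → IsTimeConstructible t →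
      Monotone t →
      (∀ᶠ n in atTop, n * s n < 2 ^ (n / e)) →
      (∀ᶠ n in atTop, ((stretch s e)^[3] n) ^ d ≤ t n) →
      (∀ L ∈ NTIME (fun n => t n ^ e), ∀ᶠ n in atTop, L.circuitSize n ≤ s n) →
        NTIMEHasWitnessCircuits t (fun n => ((stretch s e)^[3] n) ^ (2 * g))

/-- The almost-everywhere form with monotone `t` yields the literal all-lengths form FOR
MONOTONE `t`: `L ∈ SIZE s` gives `L.circuitSize n ≤ s n` at every length
(`mem_SIZE_iff_circuitSize_le_holds`), in particular eventually. (The literal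
`MurrayWilliams2018_lemma_4_1` also covers non-monotone `t`; it is proved outright, vacuously, in
`MurrayWilliams2018EasyWitnessProofs.lean`.) [folklore] -/
theorem MurrayWilliams2018_lemma_4_1_ae.size_form (h : MurrayWilliams2018_lemma_4_1_ae) :
    ∃ e g d : ℕ, 1 ≤ e ∧ 1 ≤ g ∧ 1 ≤ d ∧
      ∀ (s t : ℕ → ℕ), StrictMono s → IsTimeConstructible s → IsTimeConstructible t →
        Monotone t →
        (∀ᶠ n in atTop, n * s n < 2 ^ (n / e)) →
        (∀ᶠ n in atTop, ((stretch s e)^[3] n) ^ d ≤ t n) →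
        NTIME (fun n => t n ^ e) ⊆ SIZE s →
          NTIMEHasWitnessCircuits t (fun n => ((stretch s e)^[3] n) ^ (2 * g)) := by
  obtain ⟨e, g, d, he, hg, hd, H⟩ := h
  refine ⟨e, g, d, he, hg, hd, fun s t hs hsc htc hm ha hb hsize => H s t hs hsc htc hm ha hb ?_⟩
  intro L hL
  exact Filter.Eventually.of_forall ((mem_SIZE_iff_circuitSize_le_holds L s).1 (hsize hL))

end Literature.Computability.Complexity
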